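import Literature.Probability.RandomPlanarGeometry.HexSAWBrickWallStripFugacityArches
import HarnessLib

/-!
# Hammersley–Welsh inside a strip with two surface weights: unfolded arches are at most `μ_T(y,z)^{n+2}`, and `C_{T,n}(y,z) ≤ K_T e^{6√n} μ_T(y,z)ⁿ`

Topic `Literature/Probability/RandomPlanarGeometry` (continues `HexSAWBrickWallStripFugacityArches.lean` — unfolding inside
the brick-wall strip `S_T`: `stripZ₂_le_exp_mul_unfZ₂ : C_{T,n}(y,z) ≤ e^{6√n} U_{T,n}(y,z)`, the completion `toArch` of an
unfolded strip walk into an arch of length `m + 4T + 6`, `unfZ₂_le_of_injOn`).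

Sources.  J. M. Hammersley, D. J. A. Welsh, Quart. J. Math. Oxford 13 (1962) 108 (`c_n ≤ μⁿ e^{O(√n)}` through bridges);
N. Madras, G. Slade, *The Self-Avoiding Walk* (1993), §1.2, eq. (1.2.17) `b_n ≤ μⁿ` (p. 11: supermultiplicativity of bridges) and
§3.1, Theorem 3.1.1 / Corollary 3.1.8; N. R. Beaton, M. Bousquet-Mélou, J. de Gier, H. Duminil-Copin, A. J. Guttmann, Comm. Math.
Phys. 326 (2014), arXiv:1109.0358v5, §3.2, Proposition 6 (p. 10: the two-surface strip rate `μ_T(y,z)`; proof p. 11 by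
"concatenation and unfolding arguments").  Here the HW mechanism is run INSIDE the strip `S_T` with a fugacity on each surface:
the role of bridges is played by the UNFOLDED ARCHES (arches of `S_T` rooted at the bottom-surface vertex `(1,0)` whose
abscissa is weakly minimal at the start and maximal at the end); two of them concatenate through two horizontal steps along the
bottom row into an unfolded arch, with EXACT weight bookkeeping, so `UA_{T,m} UA_{T,n} ≤ UA_{T,m+n+2}` and hence the sharp
`UA_{T,n}(y,z) ≤ μ_T(y,z)^{n+2}`; the tree's in-strip unfolding and the arch completion then give the strip HW bound.

## Contents (namespace `Literature.Probability.RandomPlanarGeometry.SAW.HexBW`, all PROVED)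

* §1 `uarchPairs T n` (unfolded arches rooted at `botStart`), `uarchZ₂ = UA_{T,n}(y,z)`, `uarchZ₂_le_archZ₂ ≤ stripZ₂`;
  `cmpl_isWB` / **`toArch_mem_uarchPairs`** (the completion of `…Arches` is unfolded) and
  **`unfZ₂_le_uarchZ₂`** — `U_{T,m} ≤ 2(T+1)(max(1,y⁻¹)max(1,z⁻¹))^{4T+6} UA_{T,m+4T+6}` (`m` even).
* §2 the JOIN `ajoin` through two bottom-row steps: **`ajoin_spec`**, `ajoin_injOn`,
  **`uarchZ₂_mul_le : UA_{T,m}(y,z) · UA_{T,n}(y,z) ≤ UA_{T,m+2+n}(y,z)`** (`T ≥ 1`: exact supermultiplicativity);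
  `uarchZ₂_pow_le` (iterated).
* §3 **`uarchZ₂_le_pow : UA_{T,n}(y,z) ≤ μ_T(y,z)^{n+2}`** (the strip analogue of `b_n ≤ μⁿ`) and the finite-`n` LOWER bound
  **`rpow_uarchZ₂_le_stripMuY₂ : UA_{T,n}(y,z)^{1/(n+2)} ≤ μ_T(y,z)`**.
* §4 ★ **`stripZ₂_le_hw : C_{T,n}(y,z) ≤ K_T(y,z) · e^{6√n} · μ_T(y,z)ⁿ`** for every `n`, with the explicit
  `K_T(y,z) = 2(T+1) (max(1,y⁻¹)max(1,z⁻¹))^{4T+7} μ_T^{4T+9}`-type constant, and the two-sided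
  **`stripZ₂_hw_sandwich`**: `μ_Tⁿ/(max(1,y⁻¹)max(1,z⁻¹)) ≤ C_{T,n}(y,z) ≤ K_T e^{6√n} μ_Tⁿ`.
-/

noncomputable section

open Filter Topology Finset Literature.Probability.LatticeModels Literature.Probability.Percolation SimpleGraph

namespace Literature.Probability.RandomPlanarGeometry.SAW.HexBW

-- Membership in the tree's finset `Zd.saws 2 n` must never be unfolded by the elaborator (numeral lengths below).
attribute [local irreducible] Zd.saws

variable {T n : ℕ} {y z : ℝ}

/-! ### §1 Unfolded arches -/

/-- Two sites of `ℤ²` with equal coordinates are equal. [cite: MadrasSlade1993, §1.1] -/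
private theorem site_ext₂' {x z : Site 2} (h0 : x 0 = z 0) (h1 : x 1 = z 1) : x = z :=
  funext fun j => (Fin.forall_fin_two (p := fun j => x j = z j)).2 ⟨h0, h1⟩ j


/-- **Unfolded arches** of `S_T` of length `n`: arches (bottom surface → bottom surface, rooted at `botStart = (1,0)` in the
cross-section) whose abscissa is weakly minimal at the start and weakly maximal at the end — the strip's substitute for bridges.
[cite: MadrasSlade1993, §1.2, Definition 1.2.4 (bridges, p. 11) and eq. (1.2.17); BeatonBousquetMelouDeGierDuminilCopinGuttmann2014, §3.2 (arXiv v5 p. 11: unfolded arches in the proof of Proposition 7)] -/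
def uarchPairs (T n : ℕ) : Finset (Site 2 × (ℕ → Site 2)) :=
  (archPairs T n).filter fun p => p.1 = botStart ∧ ∀ i ≤ n, p.2 0 0 ≤ p.2 i 0 ∧ p.2 i 0 ≤ p.2 n 0

/-- **`UA_{T,n}(y,z)`**, the two-surface partition function of unfolded arches. [cite: BeatonBousquetMelouDeGierDuminilCopinGuttmann2014, §3.2 (arXiv v5 p. 11: the series of unfolded arches); MadrasSlade1993, §1.2, eq. (1.2.17)] -/
def uarchZ₂ (T n : ℕ) (y z : ℝ) : ℝ :=
  ∑ p ∈ uarchPairs T n, y ^ bottomVisits₀ p.1 p.2 n * z ^ topVisits₀ T p.1 p.2 n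

/-- Membership in `uarchPairs`. [cite: BeatonBousquetMelouDeGierDuminilCopinGuttmann2014, §3.2 (arXiv v5 p. 11)] -/
theorem mem_uarchPairs {p : Site 2 × (ℕ → Site 2)} :
    p ∈ uarchPairs T n ↔ p ∈ archPairs T n ∧ p.1 = botStart ∧ Wall.IsWB n p.2 := by
  rw [uarchPairs, Finset.mem_filter]; rfl

/-- `uarchPairs ⊆ archPairs`. [cite: BeatonBousquetMelouDeGierDuminilCopinGuttmann2014, §3.2 (arXiv v5 p. 11)] -/
theorem uarchPairs_subset (T n : ℕ) : uarchPairs T n ⊆ archPairs T n := Finset.filter_subset _ _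

/-- An unfolded arch is an unfolded strip pair. [cite: BeatonBousquetMelouDeGierDuminilCopinGuttmann2014, §3.2 (arXiv v5 p. 11)] -/
theorem mem_unfPairs_of_mem_uarchPairs {p : Site 2 × (ℕ → Site 2)} (hp : p ∈ uarchPairs T n) : p ∈ unfPairs T n := by
  obtain ⟨ha, -, hwb⟩ := mem_uarchPairs.1 hp
  exact mem_unfPairs.2 ⟨archPairs_subset T n ha, hwb⟩

/-- `0 ≤ UA_{T,n}(y,z)`. [cite: BeatonBousquetMelouDeGierDuminilCopinGuttmann2014, §3.2 (arXiv v5 p. 11)] -/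
theorem uarchZ₂_nonneg (T n : ℕ) (hy : 0 ≤ y) (hz : 0 ≤ z) : 0 ≤ uarchZ₂ T n y z :=
  Finset.sum_nonneg fun _ _ => mul_nonneg (pow_nonneg hy _) (pow_nonneg hz _)

/-- `UA_{T,n}(y,z) ≤ A_{T,n}(y,z)`. [cite: BeatonBousquetMelouDeGierDuminilCopinGuttmann2014, §3.2 (arXiv v5 p. 11)] -/
theorem uarchZ₂_le_archZ₂ (T n : ℕ) (hy : 0 ≤ y) (hz : 0 ≤ z) : uarchZ₂ T n y z ≤ archZ₂ T n y z :=
  Finset.sum_le_sum_of_subset_of_nonneg (uarchPairs_subset T n) fun _ _ _ => mul_nonneg (pow_nonneg hy _) (pow_nonneg hz _)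

/-- `UA_{T,n}(y,z) ≤ C_{T,n}(y,z)`. [cite: BeatonBousquetMelouDeGierDuminilCopinGuttmann2014, §3.2 (arXiv v5 p. 11)] -/
theorem uarchZ₂_le_stripZ₂ (T n : ℕ) (hy : 0 ≤ y) (hz : 0 ≤ z) : uarchZ₂ T n y z ≤ stripZ₂ T n y z :=
  (uarchZ₂_le_archZ₂ T n hy hz).trans (archZ₂_le_stripZ₂ T n hy hz)

/-- **The generic completion is UNFOLDED**: for an appended piece with non-negative, non-decreasing abscissa (maximal at its end),
the completed walk of `HexSAWBrickWallStripFugacityArches` has its abscissa weakly minimal at the start and maximal at the end.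
[cite: HammersleyTorrieWhittington1982, §2 (unfolded walks); MadrasSlade1993, §1.2, eq. (1.2.15)] -/
theorem cmpl_isWB {m : ℕ} {q : Site 2 × (ℕ → Site 2)} (hq : q ∈ unfPairs T m) (hm : m % 2 = 0)
    {S : ℕ → Site 2} {L : ℕ} (hS0 : S 0 = 0) (hSx0 : ∀ j, 0 ≤ S j 0) (hSmono : ∀ j ≤ L, S j 0 ≤ S L 0) :
    Wall.IsWB (preLen q.1 + (m + L)) (cmpl m q S) := by
  obtain ⟨hqs, hwb⟩ := mem_unfPairs.1 hq
  obtain ⟨ha, hυ, -, -⟩ := mem_stripPairs.1 hqs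
  obtain ⟨h0, hx, -, -, -⟩ := unf_arith hq hm
  obtain ⟨ha0, ha1, ha2, ha3, ha4, ha5, ha6, -, -, ha9⟩ := start_arith ha
  obtain ⟨hsh, hsh2, hsh1⟩ := botStart_add_prePiece_end ha
  obtain ⟨a, υ⟩ := q
  dsimp only at *
  -- values (from the origin): subtract `botStart` from the placed formulas
  have hpre_end := stair_apply_end 0 (a 1).toNat 1 (L := preLen a) (by omega)
  have ev_pre : ∀ i ≤ preLen a, cmpl m (a, υ) S i = prePiece a i := fun i hi => cmpl_apply_pre S hi
  have ev_mid : ∀ j ≤ m, cmpl m (a, υ) S (preLen a + j) = prePiece a (preLen a) + υ j := fun j hj =>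
    cmpl_apply_mid h0 hj
  have ev_suf : ∀ j, cmpl m (a, υ) S (preLen a + (m + j)) = prePiece a (preLen a) + (υ m + S j) := fun j =>
    cmpl_apply_suf h0 hS0 j
  -- abscissa of the prefix end
  have hPx : prePiece a (preLen a) 0 = (preLen a : ℤ) - (a 1).toNat := by rw [prePiece, hpre_end.1]
  have hP0 : ∀ i, 0 ≤ prePiece a i 0 := fun i => by
    rw [prePiece, stair_apply_zero]
    have := two_mul_stairV_le 0 (a 1).toNat (min i (preLen a))
    push_cast; omega
  have hPle : ∀ i ≤ preLen a, prePiece a i 0 ≤ prePiece a (preLen a) 0 := fun i hi =>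
    stair_apply_zero_mono 0 (a 1).toNat 1 (preLen a) hi
  intro i hi
  have hstart : cmpl m (a, υ) S 0 0 = 0 := by rw [ev_pre 0 (Nat.zero_le _), prePiece, stair_zero]; rfl
  have hend : cmpl m (a, υ) S (preLen a + (m + L)) 0 = prePiece a (preLen a) 0 + (υ m 0 + S L 0) := by
    rw [ev_suf L]; rfl
  rw [hstart, hend]
  have hxm := (hx m le_rfl).1
  have hSL := hSx0 L
  rcases le_or_gt i (preLen a) with h1 | h1
  · rw [ev_pre i h1]
    exact ⟨hP0 i, by linarith [hPle i h1]⟩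
  · obtain ⟨j, rfl⟩ : ∃ j, i = preLen a + j := ⟨i - preLen a, by omega⟩
    rcases le_or_gt j m with h2 | h2
    · rw [ev_mid j h2, Pi.add_apply]
      have := hx j h2
      exact ⟨by linarith [hP0 (preLen a)], by linarith⟩
    · obtain ⟨j', rfl⟩ : ∃ j', j = m + j' := ⟨j - m, by omega⟩
      rw [ev_suf j', Pi.add_apply, Pi.add_apply]
      have := hSmono j' (by omega)
      exact ⟨by linarith [hP0 (preLen a), hSx0 j'], by linarith⟩

/-- **The arch completion of `…Arches` is an unfolded arch.** [cite: BeatonBousquetMelouDeGierDuminilCopinGuttmann2014, §3.2 (arXiv v5 p. 11: unfolded arches); HammersleyTorrieWhittington1982, §2] -/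
theorem toArch_mem_uarchPairs {m : ℕ} {q : Site 2 × (ℕ → Site 2)} (hq : q ∈ unfPairs T m) (hm : m % 2 = 0) :
    toArch T m q ∈ uarchPairs T (m + (4 * T + 6)) := by
  obtain ⟨hmem, -⟩ := toArch_spec hq hm
  obtain ⟨ha, -, -, -⟩ := mem_stripPairs.1 (mem_unfPairs.1 hq).1
  obtain ⟨-, -, -, -, -, -, -, ha7, -, -⟩ := start_arith ha
  have hwb := cmpl_isWB hq hm (S := sufPieceA T q.1 ((q.1 + q.2 m) 1).toNat) (L := sufLenA T q.1)
    (stair_zero _ _ _ _) (fun j => by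
      rw [sufPieceA, stair_apply_zero]
      have := two_mul_stairV_le (par q.1) ((q.1 + q.2 m) 1).toNat (min j (sufLenA T q.1))
      push_cast; omega)
    (fun j hj => stair_apply_zero_mono _ _ _ _ hj)
  rw [show preLen q.1 + (m + sufLenA T q.1) = m + (4 * T + 6) by omega] at hwb
  exact mem_uarchPairs.2 ⟨hmem, rfl, hwb⟩

/-- **`U_{T,m}(y,z) ≤ 2(T+1) (max(1,y⁻¹) max(1,z⁻¹))^{4T+6} · UA_{T,m+4T+6}(y,z)`** (`m` even, `y, z > 0`): the arch completion
lands in the UNFOLDED arches. [cite: BeatonBousquetMelouDeGierDuminilCopinGuttmann2014, Proposition 6 (arXiv v5 p. 10; proof p. 11)] -/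
theorem unfZ₂_le_uarchZ₂ (T : ℕ) {m : ℕ} (hm : m % 2 = 0) (hy : 0 < y) (hz : 0 < z) :
    unfZ₂ T m y z ≤ (2 * (T + 1)) * (yK y * yK z) ^ (4 * T + 6) * uarchZ₂ T (m + (4 * T + 6)) y z :=
  unfZ₂_le_of_injOn T m (m + (4 * T + 6)) (4 * T + 6) hy hz (toArch T m) (uarchPairs T (m + (4 * T + 6)))
    (fun _ hq => ⟨toArch_mem_uarchPairs hq hm, (toArch_spec hq hm).2⟩) (toArch_injOn hm)

/-! ### §2 Joining two unfolded arches through two bottom-row steps -/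

/-- The two-step connector along the bottom row, read from the origin: `(0,0), (1,0), (2,0)`, frozen after `2`.
[cite: MadrasSlade1993, §1.2, eq. (1.2.15) (concatenation of bridges)] -/
def twoRight : ℕ → Site 2 := stair 0 0 1 2

/-- **The join** of two unfolded arches rooted at `(1,0)`: the first arch, two steps to the right along the bottom row, then
the second arch translated to start there (an even horizontal translate). [cite: MadrasSlade1993, §1.2, eq. (1.2.15) (b_M b_N ≤ b_{M+N})] -/
def ajoin (m : ℕ) (q₁ q₂ : Site 2 × (ℕ → Site 2)) : Site 2 × (ℕ → Site 2) :=
  (botStart, Zd.concatWalk m q₁.2 (Zd.concatWalk 2 twoRight q₂.2))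

/-- Coordinates of the connector up to time `2`. [cite: MadrasSlade1993, §1.2, eq. (1.2.15)] -/
theorem twoRight_apply {j : ℕ} (hj : j ≤ 2) : twoRight j 0 = (j : ℤ) ∧ twoRight j 1 = 0 := by
  refine ⟨?_, ?_⟩
  · rw [twoRight, stair_apply_zero, Nat.min_eq_left hj]; unfold stairV; push_cast; omega
  · rw [twoRight, stair_apply_one]; unfold stairV; push_cast; omega

/-- Facts about an unfolded arch `(botStart, υ)`: `υ 0 = 0`, abscissae between `0` and the final one, all rows in `[0,T]`,
brick-wall bonds, end on the bottom row at an EVEN relative abscissa.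
[cite: BeatonBousquetMelouDeGierDuminilCopinGuttmann2014, §3.2 (arXiv v5 p. 11: unfolded arches)] -/
theorem uarch_arith {p : Site 2 × (ℕ → Site 2)} (hp : p ∈ uarchPairs T n) :
    p.1 = botStart ∧ p.2 0 = 0 ∧ (∀ i ≤ n, 0 ≤ p.2 i 0 ∧ p.2 i 0 ≤ p.2 n 0) ∧ (∀ i ≤ n, 0 ≤ p.2 i 1 ∧ p.2 i 1 ≤ T) ∧
      (∀ i < n, brickWallGraph.Adj (botStart + p.2 i) (botStart + p.2 (i + 1))) ∧
      p.2 n 1 = 0 ∧ p.2 n 0 % 2 = 0 := by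
  obtain ⟨ha, h1, hwb⟩ := mem_uarchPairs.1 hp
  obtain ⟨hps, -, hbotn⟩ := mem_archPairs.1 ha
  obtain ⟨-, hυ, hbw, hstrip⟩ := mem_stripPairs.1 hps
  have h0 : p.2 0 = 0 := (Zd.mem_saws.1 hυ).1
  rw [h1] at hbw hstrip hbotn
  obtain ⟨he1, he0⟩ := hbotn
  simp only [Pi.add_apply, botStart] at he1 he0
  simp at he1 he0
  refine ⟨h1, h0, fun i hi => ?_, fun i hi => ?_, hbw, by omega, by omega⟩
  · have h := hwb i hi; rw [h0] at h; exact ⟨h.1, h.2⟩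
  · have h := hstrip i hi
    simp only [InStrip, Pi.add_apply, botStart] at h
    simp at h
    exact ⟨h.1, h.2⟩

/-- The joined walk and its values on the three pieces. [cite: MadrasSlade1993, §1.2, eq. (1.2.15)] -/
theorem ajoin_apply {m : ℕ} {υ ω : ℕ → Site 2} (hω0 : ω 0 = 0) :
    (∀ i ≤ m, Zd.concatWalk m υ (Zd.concatWalk 2 twoRight ω) i = υ i) ∧
      (∀ j ≤ 2, Zd.concatWalk m υ (Zd.concatWalk 2 twoRight ω) (m + j) = υ m + twoRight j) ∧
      (∀ j, Zd.concatWalk m υ (Zd.concatWalk 2 twoRight ω) (m + (2 + j)) = υ m + (twoRight 2 + ω j)) := by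
  have hin0 : Zd.concatWalk 2 twoRight ω 0 = 0 := by
    rw [Zd.concatWalk_apply_of_le _ _ (Nat.zero_le 2), twoRight, stair_zero]
  refine ⟨fun i hi => Zd.concatWalk_apply_of_le _ _ hi, fun j hj => ?_, fun j => ?_⟩
  · rw [Zd.concatWalk_apply_add _ _ hin0, Zd.concatWalk_apply_of_le _ _ hj]
  · rw [Zd.concatWalk_apply_add _ _ hin0, Zd.concatWalk_apply_add _ _ hω0]

/-- **The join is an unfolded arch of length `m + 2 + n` with both surface-visit counts ADDITIVE** (`T ≥ 1`).
[cite: MadrasSlade1993, §1.2, eq. (1.2.15) (p. 11: concatenation of bridges, b_M b_N ≤ b_{M+N}); BeatonBousquetMelouDeGierDuminilCopinGuttmann2014, Proposition 6 (arXiv v5 p. 10; proof p. 11: "concatenation")] -/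
theorem ajoin_spec (hT : 1 ≤ T) {m n : ℕ} {q₁ q₂ : Site 2 × (ℕ → Site 2)} (h₁ : q₁ ∈ uarchPairs T m)
    (h₂ : q₂ ∈ uarchPairs T n) :
    ajoin m q₁ q₂ ∈ uarchPairs T (m + (2 + n)) ∧
      bottomVisits₀ (ajoin m q₁ q₂).1 (ajoin m q₁ q₂).2 (m + (2 + n)) = bottomVisits₀ q₁.1 q₁.2 m + bottomVisits₀ q₂.1 q₂.2 n ∧
      topVisits₀ T (ajoin m q₁ q₂).1 (ajoin m q₁ q₂).2 (m + (2 + n)) = topVisits₀ T q₁.1 q₁.2 m + topVisits₀ T q₂.1 q₂.2 n := by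
  have hυ : q₁.2 ∈ Zd.saws 2 m := (mem_stripPairs.1 (archPairs_subset _ _ (uarchPairs_subset _ _ h₁))).2.1
  have hω : q₂.2 ∈ Zd.saws 2 n := (mem_stripPairs.1 (archPairs_subset _ _ (uarchPairs_subset _ _ h₂))).2.1
  obtain ⟨a₁, hυ0, hx₁, hy₁, hbw₁, he1, he0⟩ := uarch_arith h₁
  obtain ⟨a₂, hω0, hx₂, hy₂, hbw₂, hf1, hf0⟩ := uarch_arith h₂
  obtain ⟨a, υ⟩ := q₁
  obtain ⟨b, ω⟩ := q₂
  dsimp only at *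
  subst a₁
  subst a₂
  rw [ajoin]
  dsimp only
  set W := Zd.concatWalk m υ (Zd.concatWalk 2 twoRight ω) with hW
  obtain ⟨ev1, ev2, ev3⟩ := ajoin_apply (m := m) (υ := υ) hω0
  rw [← hW] at ev1 ev2 ev3
  have hR2 : twoRight 2 0 = 2 ∧ twoRight 2 1 = 0 := by have := twoRight_apply (le_refl 2); simpa using this
  have hR1 : twoRight 1 0 = 1 ∧ twoRight 1 1 = 0 := by have := twoRight_apply (by norm_num : 1 ≤ 2); simpa using this
  have hR0 : twoRight 0 = 0 := by rw [twoRight, stair_zero]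
  have hRs : twoRight ∈ Zd.saws 2 2 := stair_mem_zd_saws 0 0 (Or.inl rfl) 2
  have hxm := (hx₁ m le_rfl).1
  have hxn := (hx₂ n le_rfl).1
  -- the inner walk `connector ∘ ω` is self-avoiding: `ω` lives at relative abscissa ≥ 2, the connector at ≤ 2 except its end
  have hinner : Zd.concatWalk 2 twoRight ω ∈ Zd.saws 2 (2 + n) := by
    refine Zd.concatWalk_mem_saws hRs hω fun i hi j hj1 hj2 heq => ?_
    have h0x := congrFun heq 0
    have h0y := congrFun heq 1
    simp only [Pi.add_apply, (twoRight_apply hi).1, (twoRight_apply hi).2, hR2.1, hR2.2] at h0x h0y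
    have hxj := (hx₂ j hj2).1
    obtain ⟨-, -, -, hinj⟩ := Zd.mem_saws.1 hω
    have hωj : ω j = ω 0 := by
      rw [hω0]; refine site_ext₂' ?_ ?_
      · show ω j 0 = (0 : Site 2) 0; simp; omega
      · show ω j 1 = (0 : Site 2) 1; simp; omega
    exact absurd (hinj (show j ∈ {i | i ≤ n} by simpa using hj2) (show 0 ∈ {i | i ≤ n} by simp) hωj) (by omega)
  have hWs : W ∈ Zd.saws 2 (m + (2 + n)) := by
    refine Zd.concatWalk_mem_saws hυ hinner fun i hi j hj1 hj2 heq => ?_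
    have h0x := congrFun heq 0
    simp only [Pi.add_apply] at h0x
    have h1 : 1 ≤ Zd.concatWalk 2 twoRight ω j 0 := by
      rcases le_or_gt j 2 with hj | hj
      · rw [Zd.concatWalk_apply_of_le _ _ hj, (twoRight_apply hj).1]; omega
      · obtain ⟨j', rfl⟩ : ∃ j', j = 2 + j' := ⟨j - 2, by omega⟩
        rw [Zd.concatWalk_apply_add _ _ hω0, Pi.add_apply, hR2.1]
        have := (hx₂ j' (by omega)).1; omega
    have h2 := (hx₁ i hi).2
    omega
  -- brick-wall bonds of the placed join
  have hbw : IsBW (m + (2 + n)) (fun i => botStart + W i) := by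
    intro i hi
    show brickWallGraph.Adj (botStart + W i) (botStart + W (i + 1))
    rcases lt_or_ge i m with h1 | h1
    · rw [ev1 i h1.le, ev1 (i + 1) h1]; exact hbw₁ i h1
    · obtain ⟨j, rfl⟩ : ∃ j, i = m + j := ⟨i - m, by omega⟩
      rcases lt_or_ge j 2 with h2 | h2
      · rw [ev2 j h2.le, show m + j + 1 = m + (j + 1) by ring, ev2 (j + 1) h2]
        rw [brickWallGraph_adj_coord]
        left
        refine ⟨Or.inl ?_, ?_⟩
        · simp only [Pi.add_apply, (twoRight_apply h2.le).1, (twoRight_apply (show j + 1 ≤ 2 by omega)).1]; push_cast; ring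
        · simp only [Pi.add_apply, (twoRight_apply h2.le).2, (twoRight_apply (show j + 1 ≤ 2 by omega)).2]
      · obtain ⟨j', rfl⟩ : ∃ j', j = 2 + j' := ⟨j - 2, by omega⟩
        have hj' : j' < n := by omega
        rw [ev3 j', show m + (2 + j') + 1 = m + (2 + (j' + 1)) by ring, ev3 (j' + 1)]
        have ht : ((υ m + twoRight 2) 0 + (υ m + twoRight 2) 1) % 2 = 0 := by
          simp only [Pi.add_apply, hR2.1, hR2.2]; omega
        have := (adj_add_left_iff_of_even ht (botStart + ω j') (botStart + ω (j' + 1))).2 (hbw₂ j' hj')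
        convert this using 1 <;> abel
  -- in the strip
  have hstrip : ∀ i ≤ m + (2 + n), InStrip T (botStart + W i) := by
    intro i hi
    rcases le_or_gt i m with h1 | h1
    · rw [ev1 i h1]; have := hy₁ i h1
      simp only [InStrip, Pi.add_apply, botStart]; simp; exact ⟨this.1, this.2⟩
    · obtain ⟨j, rfl⟩ : ∃ j, i = m + j := ⟨i - m, by omega⟩
      rcases le_or_gt j 2 with h2 | h2
      · rw [ev2 j h2]
        simp only [InStrip, Pi.add_apply, botStart, (twoRight_apply h2).2, he1]; simp
      · obtain ⟨j', rfl⟩ : ∃ j', j = 2 + j' := ⟨j - 2, by omega⟩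
        rw [ev3 j']; have := hy₂ j' (by omega)
        simp only [InStrip, Pi.add_apply, botStart, hR2.2, he1]; simp; exact ⟨this.1, this.2⟩
  have hmem : (botStart, W) ∈ stripPairs T (m + (2 + n)) :=
    mem_stripPairs.2 ⟨(botStart_spec T).1, hWs, hbw, hstrip⟩
  have hendB : IsBotV (botStart + W (m + (2 + n))) := by
    rw [ev3 n]
    refine ⟨?_, ?_⟩
    · simp only [Pi.add_apply, botStart, hR2.2, he1, hf1]; simp
    · simp only [Pi.add_apply, botStart, hR2.1]; simp; omega
  have hWB : Wall.IsWB (m + (2 + n)) W := by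
    intro i hi
    have hW0 : W 0 0 = 0 := by rw [ev1 0 (Nat.zero_le m), hυ0]; rfl
    have hWend : W (m + (2 + n)) 0 = υ m 0 + (2 + ω n 0) := by
      rw [ev3 n]; simp only [Pi.add_apply, hR2.1]
    rw [hW0, hWend]
    rcases le_or_gt i m with h1 | h1
    · rw [ev1 i h1]; have := hx₁ i h1; omega
    · obtain ⟨j, rfl⟩ : ∃ j, i = m + j := ⟨i - m, by omega⟩
      rcases le_or_gt j 2 with h2 | h2
      · rw [ev2 j h2]; simp only [Pi.add_apply, (twoRight_apply h2).1]; omega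
      · obtain ⟨j', rfl⟩ : ∃ j', j = 2 + j' := ⟨j - 2, by omega⟩
        rw [ev3 j']; simp only [Pi.add_apply, hR2.1]; have := hx₂ j' (by omega); omega
  refine ⟨mem_uarchPairs.2 ⟨mem_archPairs.2 ⟨hmem, (botStart_spec T).2, hendB⟩, rfl, hWB⟩, ?_, ?_⟩
  · -- bottom visits add: the middle connector vertex has even abscissa
    unfold bottomVisits₀
    rw [show m + (2 + n) + 1 = m + (2 + (n + 1)) by ring, Finset.sum_range_add, Finset.sum_range_add]
    have s1 : ∑ x ∈ range m, (if (botStart + W x) 1 = 0 ∧ (botStart + W x) 0 % 2 = 1 then 1 else 0) =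
        ∑ x ∈ range m, (if (botStart + υ x) 1 = 0 ∧ (botStart + υ x) 0 % 2 = 1 then 1 else 0) :=
      Finset.sum_congr rfl fun x hx => by rw [ev1 x (Finset.mem_range.1 hx).le]
    have s2 : ∑ x ∈ range 2, (if (botStart + W (m + x)) 1 = 0 ∧ (botStart + W (m + x)) 0 % 2 = 1 then 1 else 0) =
        (if (botStart + υ m) 1 = 0 ∧ (botStart + υ m) 0 % 2 = 1 then 1 else 0) := by
      rw [Finset.sum_range_succ, Finset.sum_range_one, ev2 0 (by norm_num), ev2 1 (by norm_num), hR0, add_zero]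
      have : ¬ ((botStart + (υ m + twoRight 1)) 1 = 0 ∧ (botStart + (υ m + twoRight 1)) 0 % 2 = 1) := by
        simp only [Pi.add_apply, hR1.1, hR1.2, botStart]; simp; omega
      rw [if_neg this, add_zero]
    have s3 : ∑ x ∈ range (n + 1), (if (botStart + W (m + (2 + x))) 1 = 0 ∧ (botStart + W (m + (2 + x))) 0 % 2 = 1
        then 1 else 0) = ∑ x ∈ range (n + 1), (if (botStart + ω x) 1 = 0 ∧ (botStart + ω x) 0 % 2 = 1 then 1 else 0) := by
      refine Finset.sum_congr rfl fun x _ => ?_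
      rw [ev3 x]
      have e1' : (botStart + (υ m + (twoRight 2 + ω x))) 1 = (botStart + ω x) 1 := by
        simp only [Pi.add_apply, hR2.2, he1]; ring
      have e0' : (botStart + (υ m + (twoRight 2 + ω x))) 0 % 2 = (botStart + ω x) 0 % 2 := by
        simp only [Pi.add_apply, hR2.1]; omega
      rw [e1', e0']
    rw [s1, s2, s3, Finset.sum_range_succ _ m]
    ring
  · unfold topVisits₀
    rw [show m + (2 + n) + 1 = m + (2 + (n + 1)) by ring, Finset.sum_range_add, Finset.sum_range_add]
    have s1 : ∑ x ∈ range m, (if (botStart + W x) 1 = (T : ℤ) ∧ ((botStart + W x) 0 + T) % 2 = 0 then 1 else 0) =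
        ∑ x ∈ range m, (if (botStart + υ x) 1 = (T : ℤ) ∧ ((botStart + υ x) 0 + T) % 2 = 0 then 1 else 0) :=
      Finset.sum_congr rfl fun x hx => by rw [ev1 x (Finset.mem_range.1 hx).le]
    have s2 : ∑ x ∈ range 2, (if (botStart + W (m + x)) 1 = (T : ℤ) ∧ ((botStart + W (m + x)) 0 + T) % 2 = 0 then 1 else 0) =
        (if (botStart + υ m) 1 = (T : ℤ) ∧ ((botStart + υ m) 0 + T) % 2 = 0 then 1 else 0) := by
      rw [Finset.sum_range_succ, Finset.sum_range_one, ev2 0 (by norm_num), ev2 1 (by norm_num), hR0, add_zero]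
      have : ¬ ((botStart + (υ m + twoRight 1)) 1 = (T : ℤ) ∧ ((botStart + (υ m + twoRight 1)) 0 + T) % 2 = 0) := by
        simp only [Pi.add_apply, hR1.1, hR1.2, botStart, he1]; simp; omega
      rw [if_neg this, add_zero]
    have s3 : ∑ x ∈ range (n + 1), (if (botStart + W (m + (2 + x))) 1 = (T : ℤ) ∧
        ((botStart + W (m + (2 + x))) 0 + T) % 2 = 0 then 1 else 0) =
        ∑ x ∈ range (n + 1), (if (botStart + ω x) 1 = (T : ℤ) ∧ ((botStart + ω x) 0 + T) % 2 = 0 then 1 else 0) := by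
      refine Finset.sum_congr rfl fun x _ => ?_
      rw [ev3 x]
      have e1' : (botStart + (υ m + (twoRight 2 + ω x))) 1 = (botStart + ω x) 1 := by
        simp only [Pi.add_apply, hR2.2, he1]; ring
      have e0' : ((botStart + (υ m + (twoRight 2 + ω x))) 0 + T) % 2 = ((botStart + ω x) 0 + T) % 2 := by
        simp only [Pi.add_apply, hR2.1]; omega
      rw [e1', e0']
    rw [s1, s2, s3, Finset.sum_range_succ _ m]
    ring

/-! ### §3 Supermultiplicativity of unfolded arches and `UA_{T,n} ≤ μ_T^{n+2}` -/

/-- The join is injective on pairs of unfolded arches of given lengths. [cite: MadrasSlade1993, §1.2, eq. (1.2.15) (p. 11)] -/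
theorem ajoin_injOn (m n : ℕ) :
    Set.InjOn (fun x : (Site 2 × (ℕ → Site 2)) × (Site 2 × (ℕ → Site 2)) => ajoin m x.1 x.2)
      ↑(uarchPairs T m ×ˢ uarchPairs T n) := by
  rintro ⟨q₁, q₂⟩ hq ⟨q₁', q₂'⟩ hq' h
  obtain ⟨h₁, h₂⟩ := Finset.mem_product.1 (Finset.mem_coe.1 hq)
  obtain ⟨h₁', h₂'⟩ := Finset.mem_product.1 (Finset.mem_coe.1 hq')
  have hυ : q₁.2 ∈ Zd.saws 2 m := (mem_stripPairs.1 (archPairs_subset _ _ (uarchPairs_subset _ _ h₁))).2.1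
  have hω : q₂.2 ∈ Zd.saws 2 n := (mem_stripPairs.1 (archPairs_subset _ _ (uarchPairs_subset _ _ h₂))).2.1
  have hυ' : q₁'.2 ∈ Zd.saws 2 m := (mem_stripPairs.1 (archPairs_subset _ _ (uarchPairs_subset _ _ h₁'))).2.1
  have hω' : q₂'.2 ∈ Zd.saws 2 n := (mem_stripPairs.1 (archPairs_subset _ _ (uarchPairs_subset _ _ h₂'))).2.1
  have hRs : twoRight ∈ Zd.saws 2 2 := stair_mem_zd_saws 0 0 (Or.inl rfl) 2
  have hR0 : twoRight 0 = 0 := by rw [twoRight, stair_zero]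
  have hx₂ := (uarch_arith h₂).2.2.1
  have hx₂' := (uarch_arith h₂').2.2.1
  have hin : ∀ {ω : ℕ → Site 2}, ω ∈ Zd.saws 2 n → (∀ i ≤ n, 0 ≤ ω i 0 ∧ ω i 0 ≤ ω n 0) →
      Zd.concatWalk 2 twoRight ω ∈ Zd.saws 2 (2 + n) := by
    intro ω hω hx
    obtain ⟨hω0, -, -, hinj⟩ := Zd.mem_saws.1 hω
    have hR2 : twoRight 2 0 = 2 ∧ twoRight 2 1 = 0 := by have := twoRight_apply (le_refl 2); simpa using this
    refine Zd.concatWalk_mem_saws hRs hω fun i hi j hj1 hj2 heq => ?_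
    have h0x := congrFun heq 0
    have h0y := congrFun heq 1
    simp only [Pi.add_apply, (twoRight_apply hi).1, (twoRight_apply hi).2, hR2.1, hR2.2] at h0x h0y
    have hxj := (hx j hj2).1
    have hωj : ω j = ω 0 := by
      rw [hω0]; refine site_ext₂' ?_ ?_
      · show ω j 0 = (0 : Site 2) 0; simp; omega
      · show ω j 1 = (0 : Site 2) 1; simp; omega
    exact absurd (hinj (show j ∈ {i | i ≤ n} by simpa using hj2) (show 0 ∈ {i | i ≤ n} by simp) hωj) (by omega)
  have e : Zd.concatWalk m q₁.2 (Zd.concatWalk 2 twoRight q₂.2) = Zd.concatWalk m q₁'.2 (Zd.concatWalk 2 twoRight q₂'.2) := by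
    have := congrArg Prod.snd h; simpa [ajoin] using this
  obtain ⟨e1, e2⟩ := Zd.concatWalk_injective_pieces hυ (hin hω hx₂) hυ' (hin hω' hx₂') e
  obtain ⟨-, e3⟩ := Zd.concatWalk_injective_pieces hRs hω hRs hω' e2
  have ha₁ := (uarch_arith h₁).1
  have ha₁' := (uarch_arith h₁').1
  have ha₂ := (uarch_arith h₂).1
  have ha₂' := (uarch_arith h₂').1
  ext : 1
  · exact Prod.ext (by rw [ha₁, ha₁']) e1
  · exact Prod.ext (by rw [ha₂, ha₂']) e3

/-- **Exact supermultiplicativity of unfolded arches**: `UA_{T,m}(y,z) · UA_{T,n}(y,z) ≤ UA_{T,m+2+n}(y,z)` (`T ≥ 1`, `y, z ≥ 0`) —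
the strip analogue of `b_M b_N ≤ b_{M+N}`. [cite: MadrasSlade1993, §1.2, eq. (1.2.15) (p. 11: "The concatenation of two bridges will always yield another bridge, so b_M b_N ≤ b_{M+N}")] -/
theorem uarchZ₂_mul_le (hT : 1 ≤ T) (m n : ℕ) (hy : 0 ≤ y) (hz : 0 ≤ z) :
    uarchZ₂ T m y z * uarchZ₂ T n y z ≤ uarchZ₂ T (m + (2 + n)) y z := by
  classical
  set P := uarchPairs T m ×ˢ uarchPairs T n with hP
  set w : ℕ → Site 2 × (ℕ → Site 2) → ℝ := fun k p => y ^ bottomVisits₀ p.1 p.2 k * z ^ topVisits₀ T p.1 p.2 k with hw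
  have hmul : uarchZ₂ T m y z * uarchZ₂ T n y z = ∑ x ∈ P, w m x.1 * w n x.2 := by
    rw [uarchZ₂, uarchZ₂, Finset.sum_mul_sum, ← Finset.sum_product']
  have hjoin : ∀ x ∈ P, w m x.1 * w n x.2 = w (m + (2 + n)) (ajoin m x.1 x.2) := by
    intro x hx
    obtain ⟨h₁, h₂⟩ := Finset.mem_product.1 hx
    obtain ⟨-, hb, ht⟩ := ajoin_spec hT h₁ h₂
    simp only [hw, hb, ht, pow_add]
    ring
  have himg : P.image (fun x => ajoin m x.1 x.2) ⊆ uarchPairs T (m + (2 + n)) := by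
    intro q hq
    obtain ⟨x, hx, rfl⟩ := Finset.mem_image.1 hq
    obtain ⟨h₁, h₂⟩ := Finset.mem_product.1 hx
    exact (ajoin_spec hT h₁ h₂).1
  rw [hmul, Finset.sum_congr rfl hjoin, ← Finset.sum_image (ajoin_injOn m n)]
  exact Finset.sum_le_sum_of_subset_of_nonneg himg fun _ _ _ => mul_nonneg (pow_nonneg hy _) (pow_nonneg hz _)

/-- Iterated: `UA_{T,n}(y,z)^{k+1} ≤ UA_{T, n + k(n+2)}(y,z)`. [cite: MadrasSlade1993, §1.2, eq. (1.2.16)–(1.2.17) (p. 11)] -/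
theorem uarchZ₂_pow_le (hT : 1 ≤ T) (n : ℕ) (hy : 0 ≤ y) (hz : 0 ≤ z) (k : ℕ) :
    uarchZ₂ T n y z ^ (k + 1) ≤ uarchZ₂ T (n + k * (n + 2)) y z := by
  induction k with
  | zero => simp
  | succ k ih =>
    calc uarchZ₂ T n y z ^ (k + 1 + 1) = uarchZ₂ T n y z * uarchZ₂ T n y z ^ (k + 1) := by ring
      _ ≤ uarchZ₂ T n y z * uarchZ₂ T (n + k * (n + 2)) y z :=
          mul_le_mul_of_nonneg_left ih (uarchZ₂_nonneg T n hy hz)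
      _ ≤ uarchZ₂ T (n + (2 + (n + k * (n + 2)))) y z := uarchZ₂_mul_le hT _ _ hy hz
      _ = uarchZ₂ T (n + (k + 1) * (n + 2)) y z := by ring_nf

/-- **The finite-`n` lower bound on the strip rate from unfolded arches: `UA_{T,n}(y,z)^{1/(n+2)} ≤ μ_T(y,z)`** (`T ≥ 1`,
`y, z > 0`), by `UA_n^{k+1} ≤ UA_{n+k(n+2)} ≤ C_{T,n+k(n+2)}` and the limit `C_{T,N}^{1/N} → μ_T`.
[cite: MadrasSlade1993, §1.2, eq. (1.2.17) (p. 11: b_N ≤ μ^N) with Proposition 6 of BeatonBousquetMelouDeGierDuminilCopinGuttmann2014 (arXiv v5 p. 10)] -/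
theorem rpow_uarchZ₂_le_stripMuY₂ (hT : 1 ≤ T) (hy : 0 < y) (hz : 0 < z) (n : ℕ) :
    uarchZ₂ T n y z ^ (1 / ((n : ℝ) + 2)) ≤ stripMuY₂ T y z := by
  set U := uarchZ₂ T n y z with hU
  have hU0 : 0 ≤ U := uarchZ₂_nonneg T n hy.le hz.le
  rcases hU0.eq_or_lt with hU00 | hUpos
  · rw [← hU00, Real.zero_rpow (by positivity)]; exact (stripMuY₂_pos T hy hz).le
  -- the index `N_k = n + k (n+2) → ∞`
  set N : ℕ → ℕ := fun k => n + k * (n + 2) with hN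
  have hNtop : Tendsto N atTop atTop :=
    Filter.tendsto_atTop_atTop.2 fun b => ⟨b, fun k hk => by show b ≤ n + k * (n + 2); nlinarith⟩
  have hC := (tendsto_stripZ₂_rpow T hy hz).comp hNtop
  -- exponents `(k+1)/N_k → 1/(n+2)`
  have hexp : Tendsto (fun k : ℕ => ((k : ℝ) + 1) * (1 / (N k : ℝ))) atTop (𝓝 (1 / ((n : ℝ) + 2))) := by
    have h1 : Tendsto (fun k : ℕ => ((k : ℝ) + 1) / (((k : ℝ) + 1) * ((n : ℝ) + 2) - 2)) atTop (𝓝 (1 / ((n : ℝ) + 2))) := by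
      have hk : Tendsto (fun k : ℕ => (k : ℝ) + 1) atTop atTop := tendsto_natCast_atTop_atTop.atTop_add tendsto_const_nhds
      -- `(k+1)/((k+1)(n+2) - 2) = 1/((n+2) - 2/(k+1))`
      have h2 : Tendsto (fun k : ℕ => ((n : ℝ) + 2) - 2 / ((k : ℝ) + 1)) atTop (𝓝 (((n : ℝ) + 2) - 0)) :=
        tendsto_const_nhds.sub (tendsto_const_nhds.div_atTop hk)
      rw [sub_zero] at h2
      have h3 := h2.inv₀ (by positivity : ((n : ℝ) + 2) ≠ 0)
      rw [← one_div] at h3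
      refine h3.congr' ?_
      filter_upwards [eventually_ge_atTop 1] with k hk
      have hk0 : (k : ℝ) + 1 ≠ 0 := by positivity
      field_simp
    refine h1.congr fun k => ?_
    rw [hN]; push_cast; ring
  have hL : Tendsto (fun k : ℕ => U ^ (((k : ℝ) + 1) * (1 / (N k : ℝ)))) atTop (𝓝 (U ^ (1 / ((n : ℝ) + 2)))) :=
    tendsto_const_nhds.rpow hexp (Or.inl hUpos.ne')
  refine le_of_tendsto_of_tendsto hL hC (Filter.Eventually.of_forall fun k => ?_)
  -- `U^{(k+1)/N} = (U^{k+1})^{1/N} ≤ C_N^{1/N}`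
  simp only [Function.comp_apply]
  rw [Real.rpow_mul hU0, show ((k : ℝ) + 1) = ((k + 1 : ℕ) : ℝ) by push_cast; ring, Real.rpow_natCast]
  exact Real.rpow_le_rpow (pow_nonneg hU0 _)
    ((uarchZ₂_pow_le hT n hy.le hz.le k).trans (uarchZ₂_le_stripZ₂ T _ hy.le hz.le)) (by positivity)

/-- **`UA_{T,n}(y,z) ≤ μ_T(y,z)^{n+2}`** for every `n` (`T ≥ 1`, `y, z > 0`) — unfolded arches of the strip are bounded by the
growth rate EXACTLY, as bridges are by `μ^N`. [cite: MadrasSlade1993, §1.2, eq. (1.2.17) (p. 11: b_N ≤ μ^N)] -/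
theorem uarchZ₂_le_pow (hT : 1 ≤ T) (hy : 0 < y) (hz : 0 < z) (n : ℕ) :
    uarchZ₂ T n y z ≤ stripMuY₂ T y z ^ (n + 2) := by
  have h := rpow_uarchZ₂_le_stripMuY₂ hT hy hz n
  have hU0 : 0 ≤ uarchZ₂ T n y z := uarchZ₂_nonneg T n hy.le hz.le
  have h2 := pow_le_pow_left₀ (Real.rpow_nonneg hU0 _) h (n + 2)
  rwa [← Real.rpow_natCast (uarchZ₂ T n y z ^ (1 / ((n : ℝ) + 2))), ← Real.rpow_mul hU0,
    show (1 / ((n : ℝ) + 2)) * ((n + 2 : ℕ) : ℝ) = 1 by push_cast; field_simp, Real.rpow_one] at h2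

/-! ### §4 Hammersley–Welsh inside the strip -/

/-- **Even lengths**: `C_{T,n}(y,z) ≤ 2(T+1) (max(1,y⁻¹)max(1,z⁻¹))^{4T+6} μ_T^{4T+8} · e^{6√n} μ_T(y,z)ⁿ` (`n` even, `T ≥ 1`).
[cite: MadrasSlade1993, §3.1, Theorem 3.1.1 (c_N ≤ μ^N e^{O(√N)}); HammersleyTorrieWhittington1982, §2] -/
theorem stripZ₂_le_hw_even (hT : 1 ≤ T) (hn : n % 2 = 0) (hy : 0 < y) (hz : 0 < z) :
    stripZ₂ T n y z ≤ (2 * (T + 1)) * (yK y * yK z) ^ (4 * T + 6) * stripMuY₂ T y z ^ (4 * T + 8) *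
      (Real.exp (6 * Real.sqrt n) * stripMuY₂ T y z ^ n) := by
  have hK0 : 0 ≤ yK y * yK z := mul_nonneg (zero_le_one.trans (one_le_yK y)) (zero_le_one.trans (one_le_yK z))
  have h1 := stripZ₂_le_exp_mul_unfZ₂ T hn hy.le hz.le
  have h2 := unfZ₂_le_uarchZ₂ T hn hy hz
  have h3 := uarchZ₂_le_pow hT hy hz (n + (4 * T + 6))
  have hμ0 := (stripMuY₂_pos T hy hz).le
  calc stripZ₂ T n y z ≤ Real.exp (6 * Real.sqrt n) * unfZ₂ T n y z := h1
    _ ≤ Real.exp (6 * Real.sqrt n) * ((2 * (T + 1)) * (yK y * yK z) ^ (4 * T + 6) * stripMuY₂ T y z ^ (n + (4 * T + 6) + 2)) :=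
        mul_le_mul_of_nonneg_left (h2.trans (mul_le_mul_of_nonneg_left h3 (by positivity))) (Real.exp_nonneg _)
    _ = _ := by rw [show n + (4 * T + 6) + 2 = (4 * T + 8) + n by ring, pow_add]; ring

/-- ★ **Hammersley–Welsh inside the strip, every length**: for `T ≥ 1`, `y, z > 0`,
`C_{T,n}(y,z) ≤ K_T(y,z) · e^{6√n} · μ_T(y,z)ⁿ` with `K_T(y,z) = 2(T+1) (max(1,y⁻¹)max(1,z⁻¹))^{4T+7} μ_T^{4T+7} (μ_T + C_{T,1}(y,z))`
(odd lengths through the submultiplicativity `C_{T,N+1} ≤ max(1,y⁻¹)max(1,z⁻¹) C_{T,N} C_{T,1}`).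
[cite: MadrasSlade1993, §3.1, Theorem 3.1.1 and §8.2, eq. (8.2.2); HammersleyTorrieWhittington1982, §2; BeatonBousquetMelouDeGierDuminilCopinGuttmann2014, Proposition 6 (arXiv v5 p. 10)] -/
theorem stripZ₂_le_hw (hT : 1 ≤ T) (n : ℕ) (hy : 0 < y) (hz : 0 < z) :
    stripZ₂ T n y z ≤ (2 * (T + 1)) * (yK y * yK z) ^ (4 * T + 7) * stripMuY₂ T y z ^ (4 * T + 7) *
      (stripMuY₂ T y z + stripZ₂ T 1 y z) * (Real.exp (6 * Real.sqrt n) * stripMuY₂ T y z ^ n) := by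
  set μ := stripMuY₂ T y z with hμ
  set K := yK y * yK z with hK
  have hμ0 : 0 < μ := stripMuY₂_pos T hy hz
  have hK1 : 1 ≤ K := by rw [hK]; nlinarith [one_le_yK y, one_le_yK z]
  have hK0 : 0 < K := by linarith
  have hC1 : 0 < stripZ₂ T 1 y z := stripZ₂_pos T 1 hy hz
  have hexp : ∀ a b : ℕ, a ≤ b → Real.exp (6 * Real.sqrt a) ≤ Real.exp (6 * Real.sqrt b) := fun a b hab =>
    Real.exp_le_exp.2 (mul_le_mul_of_nonneg_left (Real.sqrt_le_sqrt (by exact_mod_cast hab)) (by norm_num))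
  rcases Nat.mod_two_eq_zero_or_one n with hn | hn
  · -- even
    refine (stripZ₂_le_hw_even hT hn hy hz).trans ?_
    rw [← hμ, ← hK]
    have hE : 0 ≤ Real.exp (6 * Real.sqrt n) * μ ^ n := by positivity
    refine mul_le_mul_of_nonneg_right ?_ hE
    -- `2(T+1) K^{4T+6} μ^{4T+8} ≤ 2(T+1) K^{4T+7} μ^{4T+7} (μ + C_1)`
    have h1 : K ^ (4 * T + 6) ≤ K ^ (4 * T + 7) := pow_le_pow_right₀ hK1 (by omega)
    have h2 : μ ^ (4 * T + 8) ≤ μ ^ (4 * T + 7) * (μ + stripZ₂ T 1 y z) := by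
      rw [pow_succ]; exact mul_le_mul_of_nonneg_left (by linarith) (by positivity)
    calc (2 * ((T : ℝ) + 1)) * K ^ (4 * T + 6) * μ ^ (4 * T + 8)
        ≤ (2 * ((T : ℝ) + 1)) * K ^ (4 * T + 7) * (μ ^ (4 * T + 7) * (μ + stripZ₂ T 1 y z)) := by
          gcongr
      _ = _ := by ring
  · -- odd: `n = N + 1`, `N` even
    obtain ⟨N, rfl⟩ : ∃ N, n = N + 1 := ⟨n - 1, by omega⟩
    have hN : N % 2 = 0 := by omega
    have hsub := stripZ₂_add_le T N 1 hy hz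
    have hev := stripZ₂_le_hw_even hT hN hy hz
    rw [← hK] at hev hsub
    have hpos1 : 0 ≤ K * stripZ₂ T 1 y z := by positivity
    calc stripZ₂ T (N + 1) y z ≤ K * stripZ₂ T N y z * stripZ₂ T 1 y z := hsub
      _ = (K * stripZ₂ T 1 y z) * stripZ₂ T N y z := by ring
      _ ≤ (K * stripZ₂ T 1 y z) * ((2 * (T + 1)) * K ^ (4 * T + 6) * μ ^ (4 * T + 8) *
            (Real.exp (6 * Real.sqrt N) * μ ^ N)) := mul_le_mul_of_nonneg_left hev hpos1
      _ ≤ (K * stripZ₂ T 1 y z) * ((2 * (T + 1)) * K ^ (4 * T + 6) * μ ^ (4 * T + 8) *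
            (Real.exp (6 * Real.sqrt ((N + 1 : ℕ) : ℝ)) * μ ^ N)) := by
          gcongr
          · exact Nat.le_succ N
      _ = (2 * (T + 1)) * K ^ (4 * T + 7) * μ ^ (4 * T + 7) * stripZ₂ T 1 y z *
            (Real.exp (6 * Real.sqrt ((N + 1 : ℕ) : ℝ)) * μ ^ (N + 1)) := by ring
      _ ≤ (2 * (T + 1)) * K ^ (4 * T + 7) * μ ^ (4 * T + 7) * (μ + stripZ₂ T 1 y z) *
            (Real.exp (6 * Real.sqrt ((N + 1 : ℕ) : ℝ)) * μ ^ (N + 1)) := by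
          gcongr
          exact le_add_of_nonneg_left hμ0.le

/-- ★ **The two-sided Hammersley–Welsh sandwich in the strip**: for `T ≥ 1`, `y, z > 0`, `n ≥ 1`,
`μ_T(y,z)ⁿ / (max(1,y⁻¹)max(1,z⁻¹)) ≤ C_{T,n}(y,z) ≤ K_T(y,z) e^{6√n} μ_T(y,z)ⁿ`.
[cite: MadrasSlade1993, §1.2, eq. (1.2.10) and §3.1, Theorem 3.1.1 (μ^N ≤ c_N ≤ μ^N e^{O(√N)})] -/
theorem stripZ₂_hw_sandwich (hT : 1 ≤ T) {n : ℕ} (hn : n ≠ 0) (hy : 0 < y) (hz : 0 < z) :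
    stripMuY₂ T y z ^ n / (yK y * yK z) ≤ stripZ₂ T n y z ∧
      stripZ₂ T n y z ≤ (2 * (T + 1)) * (yK y * yK z) ^ (4 * T + 7) * stripMuY₂ T y z ^ (4 * T + 7) *
        (stripMuY₂ T y z + stripZ₂ T 1 y z) * (Real.exp (6 * Real.sqrt n) * stripMuY₂ T y z ^ n) := by
  have hK0 : 0 < yK y * yK z := mul_pos (zero_lt_one.trans_le (one_le_yK y)) (zero_lt_one.trans_le (one_le_yK z))
  refine ⟨?_, stripZ₂_le_hw hT n hy hz⟩
  rw [div_le_iff₀ hK0]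
  have h := stripMuY₂_pow_le T hy hz hn
  linarith [h]

end Literature.Probability.RandomPlanarGeometry.SAW.HexBW
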